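import Mathlib
import Summits.ValiantsHypothesis.ValiantsHypothesis.Theorems.KPlusLogSqLawWeakLiftingTowerGraftSpikePotential

/-!
# Tower graft line — IN-SECTOR REAL EVENTS COST TWO CROSSINGS EACH (T1, one-sided)

Mechanism file for the line `Cruxes/WeakLifting/Lines/tower_graft.lean` (crux `WeakLifting` = stmt-ValiantsHypothesis-19561,
memo `tower_graft-S5.md` §3 T1 «log-slope localisation»); sequel of `…TowerGraftSectorFreeGraft.lean` (no in-sector events ⇒ one
crossing), `…TowerGraftSectorRootSums.lean` and `…TowerGraftSpikePotential.lean` (machinery).  NO stub is claimed.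

THE THEOREM (`card_posRoots_add_X_pow_mul_le_of_realEvents`).  `A, E ∈ ℝ[X]` non-zero, `0 < s ≤ 1`; every complex root of `E` off
the sector (`s·‖z‖ ≤ |Im z| ∨ Re z ≤ 0`), every complex root of `A` off the sector OR a positive real; steepness
`4·(natDegree A + natDegree E) ≤ s·D`.  Then
`#{t > 0 : (A + X^D·E)(t) = 0} ≤ 2·#{t > 0 : A(t) = 0} + 1`:
each in-sector REAL event of the digit `A` costs at most two crossings of the steep arc, the sector-free background one.

PROOF (memo `HOME/val-sym-lift-p1/g20/memo/T1-CORNER-liftp1g20.md` §2).  The tree's scalar Rolle–Schur count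
(`RolleSchur.posRoots_le_scalar`, applied to `h = A + X^D E`, `a = E`, `e = D`) gives `Z₊(h) ≤ Z₊(W) + Z₊(E) + 1 + #common`
with the RESIDUAL `W = X(h′E − hE′) − D·hE = X(A′E − AE′) − D·AE` (the far digit is killed by its own exponent,
`residual_graft_eq`); `E` is sector-free so `Z₊(E) = #common = 0`.  Off the roots of `A`, `W = A·E·Φ` with the LOG-SLOPE POTENTIAL
`Φ(t) = t·A′/A − D − t·E′/E = F(t) + g(t) − D`, where `g(t) = Σ_r μ_r·t/(t − r)` runs over the positive roots of `A` and
`|F| ≤ n/s` collects the off-sector roots (`n = deg A + deg E`).  Every spike `t/(t − r)` is DECREASING, so `g` is antitone on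
each root-free interval; where `g ≥ D − n/s` (the only place `Φ` can vanish) the potential is strictly θ-concave:
`t·Φ′ ≤ n/s² − (g₊²/k − g₊) < 0` (Cauchy–Schwarz over the `k` spikes below `t`, `g₊ ≥ 3D/4`, `D·s ≥ 4n`).  Hence between two
consecutive positive roots of `A` the potential vanishes at most once off the roots, and never below the first root: the positive roots
of `W` off `A = 0` are separated by roots of `A` (`RolleSchur.card_le_card_add_one_of_separated`), so `Z₊(W) ≤ 2·Z₊(A)`.

HONEST FRAMING.  One-sided (the digit `E` must be sector-free); the MIXED case (both digits with positive roots, interleaved in a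
cluster) is where T1 stops today (memo §3).  Nothing on S4/S4b/S5, TowerB, `WeakLifting`, Conjecture B, `MatrixDescartes` (18050)
or `VP ≠ VNP`.  Def-free.  Seat: prover val-sym-lift-p1 g20, `--supports stmt-ValiantsHypothesis-19561`.
-/

-- `Summit.ValiantsHypothesis.ValiantsHypothesis.…` repeats a component by the D-0017 layout
-- (single-conjunct summit), which the `dupNamespace` linter flags; the name is mandated.
set_option linter.dupNamespace false

namespace Summit.ValiantsHypothesis.ValiantsHypothesis.Theorems.KPlusLogSqLaw.TowerGraft

open Polynomial
open scoped BigOperators Polynomial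

/-! ## The theorem -/

section Main

/-- **IN-SECTOR REAL EVENTS, ONE-SIDED (T1).**  Let `A, E ∈ ℝ[X]` be non-zero, `0 < s ≤ 1`; suppose every complex root of
`E` lies off the sector (`s·‖z‖ ≤ |Im z| ∨ Re z ≤ 0`), every complex root of `A` lies off the sector OR is a positive real,
and `4·(natDegree A + natDegree E) ≤ s·D`.  Then the graft `A + X^D·E` has at most `2·#{positive roots of A} + 1` positive
roots: each in-sector REAL event costs at most two crossings. [this work] -/
theorem card_posRoots_add_X_pow_mul_le_of_realEvents {s : ℝ} (hs : 0 < s) (hs1 : s ≤ 1) (A E : ℝ[X]) (D : ℕ)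
    (hA : A ≠ 0) (hE : E ≠ 0)
    (hrA : ∀ z ∈ (A.map Complex.ofRealHom).roots, (s * ‖z‖ ≤ |z.im| ∨ z.re ≤ 0) ∨ (z.im = 0 ∧ 0 < z.re))
    (hrE : ∀ z ∈ (E.map Complex.ofRealHom).roots, s * ‖z‖ ≤ |z.im| ∨ z.re ≤ 0)
    (hdeg : 4 * ((A.natDegree : ℝ) + E.natDegree) ≤ s * D) :
    ((A + X ^ D * E).roots.toFinset.filter (fun t => 0 < t)).card ≤
      2 * (A.roots.toFinset.filter (fun t => 0 < t)).card + 1 := by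
  classical
  -- §a  degenerate steepness: `D = 0` forces constant digits, and a constant has no roots
  rcases Nat.eq_zero_or_pos D with hD0 | hDpos
  · subst hD0
    have h1 : (A.natDegree : ℝ) + E.natDegree ≤ 0 := by
      have : (4 : ℝ) * ((A.natDegree : ℝ) + E.natDegree) ≤ s * ((0 : ℕ) : ℝ) := hdeg
      rw [Nat.cast_zero, mul_zero] at this
      linarith
    have hA0 : A.natDegree = 0 := by exact_mod_cast le_antisymm (by linarith [Nat.cast_nonneg (α := ℝ) E.natDegree]) (Nat.cast_nonneg (α := ℝ) A.natDegree)
    have hE0 : E.natDegree = 0 := by exact_mod_cast le_antisymm (by linarith [Nat.cast_nonneg (α := ℝ) A.natDegree]) (Nat.cast_nonneg (α := ℝ) E.natDegree)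
    obtain ⟨a, ha⟩ := Polynomial.natDegree_eq_zero.mp hA0
    obtain ⟨e, he⟩ := Polynomial.natDegree_eq_zero.mp hE0
    have : A + X ^ 0 * E = C (a + e) := by rw [← ha, ← he, pow_zero, one_mul, C_add]
    rw [this, Polynomial.roots_C]
    simp
  have hDR : (0 : ℝ) < D := by exact_mod_cast hDpos
  -- §b  `E` has no positive roots; the Rolle–Schur count `Z₊(h) ≤ Z₊(W) + 1`
  have hEt : ∀ t : ℝ, 0 < t → E.eval t ≠ 0 := fun t ht => eval_ne_zero_of_offSector hs E hE hrE ht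
  by_cases hh0 : A + X ^ D * E = 0
  · rw [hh0, Polynomial.roots_zero]; simp
  have hRS := LacunarySymmetroidMatrixDescartes.RolleSchur.posRoots_le_scalar (A + X ^ D * E) E (D : ℝ) hh0
  rw [residual_graft_eq] at hRS
  have hZE : (E.roots.toFinset.filter (fun x => 0 < x)).card = 0 := by
    refine Finset.card_eq_zero.mpr (Finset.filter_eq_empty_iff.mpr fun t ht hpos => ?_)
    exact hEt t hpos ((Polynomial.mem_roots hE).mp (Multiset.mem_toFinset.mp ht))
  have hZcommon : ((A + X ^ D * E).roots.toFinset.filter (fun x => 0 < x ∧ E.IsRoot x)).card = 0 := by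
    refine Finset.card_eq_zero.mpr (Finset.filter_eq_empty_iff.mpr fun t _ hpos => ?_)
    exact hEt t hpos.1 hpos.2
  rw [hZE, hZcommon] at hRS
  -- §c  notation: the residual `W`, the complex roots, the positive real roots of `A`
  set W : ℝ[X] := X * (derivative A * E - A * derivative E) - C (D : ℝ) * (A * E) with hW
  set PA := A.roots.toFinset.filter (fun t => 0 < t) with hPA
  set n : ℝ := (A.natDegree : ℝ) + E.natDegree with hn
  have hAc : A.map Complex.ofRealHom ≠ 0 := (Polynomial.map_ne_zero_iff Complex.ofRealHom.injective).mpr hA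
  set RA := (A.map Complex.ofRealHom).roots with hRA
  set RE := (E.map Complex.ofRealHom).roots with hRE
  set OFF := RA.filter (fun z => s * ‖z‖ ≤ |z.im| ∨ z.re ≤ 0) with hOFF
  set RP := RA.filter (fun z => ¬ (s * ‖z‖ ≤ |z.im| ∨ z.re ≤ 0)) with hRP
  set RPr : Multiset ℝ := RP.map Complex.re with hRPr
  have hRA_split : RA = OFF + RP := (Multiset.filter_add_not _ RA).symm
  have hOFF_off : ∀ z ∈ OFF, s * ‖z‖ ≤ |z.im| ∨ z.re ≤ 0 := fun z hz => (Multiset.mem_filter.mp hz).2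
  have hRP_real : ∀ z ∈ RP, z.im = 0 ∧ 0 < z.re := by
    intro z hz
    obtain ⟨hzA, hzoff⟩ := Multiset.mem_filter.mp hz
    exact (hrA z hzA).resolve_left hzoff
  have hRP_eq : RP = RPr.map (fun a : ℝ => (a : ℂ)) := by
    rw [hRPr, Multiset.map_map]
    conv_lhs => rw [← Multiset.map_id RP]
    refine Multiset.map_congr rfl fun z hz => ?_
    obtain ⟨him, -⟩ := hRP_real z hz
    exact Complex.ext (by simp) (by simp [him])
  have hRPr_pos : ∀ a ∈ RPr, 0 < a := by
    intro a ha
    obtain ⟨z, hz, rfl⟩ := Multiset.mem_map.mp ha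
    exact (hRP_real z hz).2
  have hev : ∀ (Q : ℝ[X]) (x : ℝ), (Q.map Complex.ofRealHom).eval (x : ℂ) = ((Q.eval x : ℝ) : ℂ) := fun Q x => by
    rw [Polynomial.eval_map, ← Complex.ofRealHom_eq_coe, Polynomial.eval₂_at_apply, Complex.ofRealHom_eq_coe]
  have hRPr_root : ∀ a ∈ RPr, A.eval a = 0 := by
    intro a ha
    obtain ⟨z, hz, rfl⟩ := Multiset.mem_map.mp ha
    obtain ⟨him, -⟩ := hRP_real z hz
    have hzA : z ∈ RA := (Multiset.mem_filter.mp hz).1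
    have hz' : (z.re : ℂ) = z := Complex.ext (by simp) (by simp [him])
    have h0 := (Polynomial.mem_roots hAc).mp hzA
    rw [Polynomial.IsRoot.def, ← hz', hev] at h0
    exact_mod_cast h0
  have hRPr_PA : ∀ a ∈ RPr, a ∈ PA := by
    intro a ha
    rw [hPA, Finset.mem_filter, Multiset.mem_toFinset, Polynomial.mem_roots hA]
    exact ⟨hRPr_root a ha, hRPr_pos a ha⟩
  have hRPr_ne : ∀ t : ℝ, A.eval t ≠ 0 → ∀ a ∈ RPr, a ≠ t := by
    intro t hAt a ha hat
    exact hAt (hat ▸ hRPr_root a ha)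
  -- cardinalities
  have hcardRA : (Multiset.card RA : ℝ) = A.natDegree := by
    rw [hRA, ← (IsAlgClosed.splits (A.map Complex.ofRealHom)).natDegree_eq_card_roots,
      Polynomial.natDegree_map_eq_of_injective Complex.ofRealHom.injective]
  have hcardRE : (Multiset.card RE : ℝ) = E.natDegree := by
    rw [hRE, ← (IsAlgClosed.splits (E.map Complex.ofRealHom)).natDegree_eq_card_roots,
      Polynomial.natDegree_map_eq_of_injective Complex.ofRealHom.injective]
  have hcardOFF : (Multiset.card OFF : ℝ) ≤ A.natDegree := by
    rw [← hcardRA]; exact_mod_cast Multiset.card_le_card (Multiset.filter_le _ RA)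
  have hcardRPr : (Multiset.card RPr : ℝ) ≤ A.natDegree := by
    rw [hRPr, Multiset.card_map, ← hcardRA]; exact_mod_cast Multiset.card_le_card (Multiset.filter_le _ RA)
  -- §d  the spike sum `g`, the potential `Φ`, their derivatives
  set g : ℝ → ℝ := fun t => (RPr.map fun a => t / (t - a)).sum with hg
  set g' : ℝ → ℝ := fun t => (RPr.map fun a => -a / (t - a) ^ 2).sum with hg'
  set Φ : ℝ → ℝ := fun t => t * (A.derivative.eval t / A.eval t) - D - t * (E.derivative.eval t / E.eval t) with hΦ
  set Φ' : ℝ → ℝ := fun t => ((RA.map fun z => -z / ((t : ℂ) - z) ^ 2).sum).re -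
      ((RE.map fun z => -z / ((t : ℂ) - z) ^ 2).sum).re with hΦ'
  have hΦderiv : ∀ t : ℝ, 0 < t → A.eval t ≠ 0 → HasDerivAt Φ (Φ' t) t := by
    intro t ht hAt
    have hdA := hasDerivAt_mul_logDeriv A hA hAt
    have hdE := hasDerivAt_mul_logDeriv E hE (hEt t ht)
    exact (hdA.sub_const (D : ℝ)).sub hdE
  have hgderiv : ∀ t : ℝ, A.eval t ≠ 0 → HasDerivAt g (g' t) t := by
    intro t hAt
    have hne : ∀ z ∈ RPr.map (fun a : ℝ => (a : ℂ)), (t : ℂ) ≠ z := by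
      intro z hz htz
      obtain ⟨a, ha, rfl⟩ := Multiset.mem_map.mp hz
      exact hRPr_ne t hAt a ha (by exact_mod_cast htz.symm)
    have hd := hasDerivAt_rootSum_re (RPr.map fun a : ℝ => (a : ℂ)) hne
    rw [rootSumDeriv_ofReal_re] at hd
    refine hd.congr_of_eventuallyEq (Filter.Eventually.of_forall fun x => ?_)
    exact (rootSum_ofReal_re RPr x).symm
  -- §e  decomposition `Φ = Re S_OFF − Re S_RE + g − D` and `|Re S_OFF − Re S_RE| ≤ n/s`
  have hdecomp : ∀ t : ℝ, 0 < t → A.eval t ≠ 0 →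
      |Φ t - (g t - D)| ≤ n / s := by
    intro t ht hAt
    have hA' := mul_logDeriv_eq_rootSum_re A hAt
    have hE' := mul_logDeriv_eq_rootSum_re E (hEt t ht)
    have hsplit : (((A.map Complex.ofRealHom).roots.map fun z => (t : ℂ) / ((t : ℂ) - z)).sum).re =
        ((OFF.map fun z => (t : ℂ) / ((t : ℂ) - z)).sum).re + g t := by
      rw [← hRA, hRA_split, Multiset.map_add, Multiset.sum_add, Complex.add_re, hRP_eq, rootSum_ofReal_re]
    have hF : Φ t - (g t - D) = ((OFF.map fun z => (t : ℂ) / ((t : ℂ) - z)).sum).re -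
        ((RE.map fun z => (t : ℂ) / ((t : ℂ) - z)).sum).re := by
      simp only [hΦ]
      rw [hA', hE', hsplit]
      ring
    rw [hF]
    have h1 := abs_rootSum_re_le hs hs1 ht OFF hOFF_off
    have h2 := abs_rootSum_re_le hs hs1 ht RE (by rw [hRE]; exact hrE)
    calc |((OFF.map fun z => (t : ℂ) / ((t : ℂ) - z)).sum).re - ((RE.map fun z => (t : ℂ) / ((t : ℂ) - z)).sum).re|
        ≤ |((OFF.map fun z => (t : ℂ) / ((t : ℂ) - z)).sum).re| + |((RE.map fun z => (t : ℂ) / ((t : ℂ) - z)).sum).re| :=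
          abs_sub _ _
      _ ≤ Multiset.card OFF / s + Multiset.card RE / s := add_le_add h1 h2
      _ ≤ A.natDegree / s + E.natDegree / s :=
          add_le_add (div_le_div_of_nonneg_right hcardOFF hs.le) (by rw [hcardRE])
      _ = n / s := by rw [hn, add_div]
  -- §f  curvature: where `g ≥ D − n/s`, `Φ′ < 0`
  have hns : n / s ≤ D / 4 := by rw [div_le_iff₀ hs]; linarith
  have hcurv : ∀ t : ℝ, 0 < t → A.eval t ≠ 0 → D - n / s ≤ g t → Φ' t < 0 := by
    intro t ht hAt hgt
    -- split the `A`-root derivative sum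
    have hsplit : ((RA.map fun z => -z / ((t : ℂ) - z) ^ 2).sum).re =
        ((OFF.map fun z => -z / ((t : ℂ) - z) ^ 2).sum).re + g' t := by
      rw [hRA_split, Multiset.map_add, Multiset.sum_add, Complex.add_re, hRP_eq, rootSumDeriv_ofReal_re]
    have hb1 := abs_mul_rootSumDeriv_re_le hs hs1 ht OFF hOFF_off
    have hb2 := abs_mul_rootSumDeriv_re_le hs hs1 ht RE (by rw [hRE]; exact hrE)
    -- the spikes: Cauchy–Schwarz curvature
    set lp := RPr.filter fun a => a < t with hlp
    set gp := (lp.map fun a => t / (t - a)).sum with hgp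
    have hcurvRP := spike_curvature RPr ht hRPr_pos (hRPr_ne t hAt)
    have hgp_ge : D - n / s ≤ gp := hgt.trans (spikeSum_le_filter RPr ht (hRPr_ne t hAt))
    have hgp_pos : 0 < gp := by linarith
    have hk1 : (1 : ℝ) ≤ Multiset.card lp := by
      have : lp ≠ 0 := by
        intro h0
        rw [hgp, h0, Multiset.map_zero, Multiset.sum_zero] at hgp_pos
        exact lt_irrefl _ hgp_pos
      exact_mod_cast Nat.one_le_iff_ne_zero.mpr (fun h => this (Multiset.card_eq_zero.mp h))
    have hkn : (Multiset.card lp : ℝ) ≤ n := by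
      have : (Multiset.card lp : ℝ) ≤ Multiset.card RPr := by exact_mod_cast Multiset.card_le_card (Multiset.filter_le _ RPr)
      linarith [Nat.cast_nonneg (α := ℝ) E.natDegree]
    have hn1 : 1 ≤ n := le_trans hk1 hkn
    have harith := transition_zone_arith hs hs1 hn1 hk1 hkn (by linarith) hgp_ge hcurvRP
    -- assemble `t·Φ′ < 0`
    have htΦ' : t * Φ' t = t * ((OFF.map fun z => -z / ((t : ℂ) - z) ^ 2).sum).re -
        t * ((RE.map fun z => -z / ((t : ℂ) - z) ^ 2).sum).re + t * g' t := by
      simp only [hΦ']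
      rw [hsplit]
      ring
    have hneg : t * Φ' t < 0 := by
      rw [htΦ']
      have e1 := le_abs_self (t * ((OFF.map fun z => -z / ((t : ℂ) - z) ^ 2).sum).re)
      have e2 := neg_abs_le (t * ((RE.map fun z => -z / ((t : ℂ) - z) ^ 2).sum).re)
      have e3 : (Multiset.card OFF : ℝ) / s ^ 2 + Multiset.card RE / s ^ 2 ≤ n / s ^ 2 := by
        rw [← add_div, hn, ← hcardRE]
        exact div_le_div_of_nonneg_right (by linarith) (by positivity)
      linarith
    by_contra hcon
    exact absurd hneg (not_lt.mpr (mul_nonneg ht.le (not_lt.mp hcon)))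
  -- §g  at a zero of the potential (a root of `W` off `A = 0`): `g ≥ D − n/s`, hence a root of `A` below
  have hΦzero : ∀ t : ℝ, 0 < t → A.eval t ≠ 0 → W.eval t = 0 → Φ t = 0 := by
    intro t ht hAt hWt
    have h0 := residual_eval_eq A E D hAt (hEt t ht)
    rw [hWt] at h0
    rcases mul_eq_zero.mp h0.symm with h1 | h1
    · exact absurd h1 (mul_ne_zero hAt (hEt t ht))
    · exact h1
  have hg_ge : ∀ t : ℝ, 0 < t → A.eval t ≠ 0 → Φ t = 0 → D - n / s ≤ g t := by
    intro t ht hAt hΦt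
    have h1 := hdecomp t ht hAt
    rw [hΦt, zero_sub, abs_neg] at h1
    have h2 := le_abs_self (g t - D)
    have h3 := neg_abs_le (g t - D)
    linarith
  have hroot_below : ∀ t : ℝ, 0 < t → A.eval t ≠ 0 → Φ t = 0 → ∃ a ∈ RPr, a < t := by
    intro t ht hAt hΦt
    by_contra hno
    push Not at hno
    have hgt : g t ≤ 0 := spikeSum_nonpos_of_lt RPr ht fun a ha =>
      lt_of_le_of_ne (hno a ha) (hRPr_ne t hAt a ha).symm
    have := hg_ge t ht hAt hΦt
    linarith
  -- §h  the positive roots of `W`: on `A = 0` (at most `#PA`) and off it (separated by roots of `A`)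
  by_cases hW0 : W = 0
  · have : (W.roots.toFinset.filter (fun x => 0 < x)).card = 0 := by rw [hW0, Polynomial.roots_zero]; simp
    rw [this] at hRS
    omega
  set ZW := W.roots.toFinset.filter (fun x => 0 < x) with hZW
  set T₁ := ZW.filter (fun x => A.IsRoot x) with hT₁
  set T₂ := ZW.filter (fun x => ¬ A.IsRoot x) with hT₂
  have hZW_split : ZW.card = T₁.card + T₂.card := (Finset.card_filter_add_card_filter_not _).symm
  have hT₁ : T₁.card ≤ PA.card := by
    refine Finset.card_le_card fun t ht => ?_
    rw [hT₁, Finset.mem_filter, hZW, Finset.mem_filter] at ht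
    rw [hPA, Finset.mem_filter, Multiset.mem_toFinset, Polynomial.mem_roots hA]
    exact ⟨ht.2, ht.1.2⟩
  have hT₂mem : ∀ t ∈ T₂, 0 < t ∧ A.eval t ≠ 0 ∧ Φ t = 0 := by
    intro t ht
    rw [hT₂, Finset.mem_filter, hZW, Finset.mem_filter, Multiset.mem_toFinset] at ht
    obtain ⟨⟨hW, hpos⟩, hAt⟩ := ht
    have hWt : W.eval t = 0 := (Polynomial.mem_roots hW0).mp hW
    exact ⟨hpos, hAt, hΦzero t hpos hAt hWt⟩
  have hT₂ : T₂.card ≤ PA.card := by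
    have hsep : ∀ x ∈ insert (0 : ℝ) T₂, ∀ y ∈ insert (0 : ℝ) T₂, x < y → ∃ u ∈ PA, x < u ∧ u < y := by
      intro x hx y hy hxy
      rcases Finset.mem_insert.mp hy with rfl | hy
      · rcases Finset.mem_insert.mp hx with rfl | hx
        · exact absurd hxy (lt_irrefl _)
        · exact absurd ((hT₂mem x hx).1.trans hxy) (lt_irrefl _)
      obtain ⟨hy0, hAy, hΦy⟩ := hT₂mem y hy
      rcases Finset.mem_insert.mp hx with rfl | hx
      · -- a root of `A` below `y`
        obtain ⟨a, ha, hay⟩ := hroot_below y hy0 hAy hΦy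
        exact ⟨a, hRPr_PA a ha, hRPr_pos a ha, hay⟩
      · -- two zeros of `Φ` off `A = 0`: a root of `A` between
        obtain ⟨hx0, hAx, hΦx⟩ := hT₂mem x hx
        by_contra hno
        push Not at hno
        have hfree : ∀ t ∈ Set.Icc x y, A.eval t ≠ 0 := by
          intro t ht hAt0
          rcases eq_or_lt_of_le ht.1 with h | h
          · exact hAx (h ▸ hAt0)
          rcases eq_or_lt_of_le ht.2 with h' | h'
          · exact hAy (h' ▸ hAt0)
          have htPA : t ∈ PA := by
            rw [hPA, Finset.mem_filter, Multiset.mem_toFinset, Polynomial.mem_roots hA]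
            exact ⟨hAt0, hx0.trans h⟩
          exact absurd h' (not_lt.mpr (hno t htPA h))
        have hpos : ∀ t ∈ Set.Icc x y, 0 < t := fun t ht => hx0.trans_le ht.1
        exact potential_no_two_zeros hxy
          (fun t ht => hΦderiv t (hpos t ht) (hfree t ht))
          (fun t ht => hgderiv t (hfree t ht))
          (fun t _ => spikeDeriv_nonpos RPr t hRPr_pos)
          (fun t ht hL => hcurv t (hpos t ht) (hfree t ht) hL)
          (hg_ge y hy0 hAy hΦy) hΦx hΦy
    have hcard := LacunarySymmetroidMatrixDescartes.RolleSchur.card_le_card_add_one_of_separated _ PA hsep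
    have h0 : (0 : ℝ) ∉ T₂ := fun h => lt_irrefl _ (hT₂mem 0 h).1
    rw [Finset.card_insert_of_notMem h0] at hcard
    omega
  -- §i  assembly
  have hZW : ZW.card ≤ 2 * PA.card := by omega
  omega

end Main

end Summit.ValiantsHypothesis.ValiantsHypothesis.Theorems.KPlusLogSqLaw.TowerGraft
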